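import Literature.RingTheory.Smooth.AugmentationIdealCotangentBaseChange   -- ★ tree: `augIdeal ε`, `charpoly_mapCotangent_baseChange` (A-p03∕A-p10 lineage, row II-2β)
import Mathlib.RingTheory.Smooth.StandardSmoothCotangent
import Mathlib.RingTheory.Smooth.Basic
import Mathlib.LinearAlgebra.Dimension.Constructions
import Mathlib.LinearAlgebra.Dimension.Free
import Mathlib.LinearAlgebra.TensorProduct.Basis
import HarnessLib

/-!
# The conormal module `I/I²` of the augmentation ideal of a SMOOTH augmented algebra is free; for a standard smooth algebra of relative
# dimension `n` it is free of rank `n` (EGA IV₄ 16.9.8 ∕ 17.2.5; Görtz–Wedhorn II Prop. 27.15, Rem. 27.18; Stacks 031I, 00RU)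

Topic `Literature/RingTheory/Smooth`, namespace `Literature.RingTheory.Smooth`.  THEOREMS ONLY (no definition, no instance, no notation, no named fact, no `sorry`);
everything from Mathlib (`RingTheory/Kaehler/Basic`: the conormal sequence `I/I² → R ⊗_S Ω[S⁄R] → Ω[R⁄R] = 0`; `RingTheory/Smooth/Basic`: for `R` formally smooth over `R`
the first map is SPLIT INJECTIVE, Stacks 031I; `RingTheory/Smooth/StandardSmoothCotangent`: `Ω[S⁄R]` is free of rank `n` for `S` standard smooth of relative dimension `n`).
Cell `pub/hodgecm-mathlib` (D-0151), programme P6 «MOD» (director s872∕s873∕s878: generic organs first), ROW 3 organ **L3.1 «`Lie(A∕S) = (e^*Ω¹_{A∕S})ᵛ`»**, brick (D1a) of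
A-p01 (g22)'s census `F0/P6/A-p01/CENSUS-L31-LieConstruction.A-p01g22.md` (754bb3cc): the ALGEBRA half of «the conormal module of the unit section of a smooth group scheme of
relative dimension `g` over `Spec R` is locally free of rank `g`» — kit author A-p07 (g17) (`F0/P6-kit/KottwitzCondition.desk`, the `LieRealisation` socket this row replaces).
HONEST LABEL: HC_CM is proved only modulo the cell's 2 remaining named inputs (hLiu418 24832, h413 24833) until rung 0 closes; this file is unconditional commutative algebra
on `--supports stmt-HodgeConjecture-24832` and pays no letter by itself.

THE SETTING.  `R` a commutative ring, `S` a commutative `R`-algebra with an AUGMENTATION `ε : S →ₐ[R] R` (the affine algebra of a SECTION `e : Spec R → Spec S ⊆ X` of an `R`-scheme,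
in the application the unit section of an abelian scheme on an affine chart, ★ `Morphisms/SectionConormalChart.sectionAug`), `I := augIdeal ε = ker ε` (★
`AugmentationIdealCotangentBaseChange`), `I/I² = I.Cotangent` the CONORMAL MODULE of the section — `e^*(𝒥∕𝒥²) = e^*Ω¹_{X∕R} = ω_{X∕R}`, whose `R`-dual is `Lie(X∕R)`
([GortzWedhorn2023] Def. 27.17, Rem. 27.18; [BoschLutkebohmertRaynaud1990] §4.2 Prop. 2).
* §1 (generalising the tree's field case ★ `Smooth/CotangentDimensionAtRationalPoint` from a field `K` to any ring `R`) The conormal sequence of a section is an ISOMORPHISM `I/I² ≅ R ⊗_S Ω[S⁄R]` as soon as `S` is formally smooth over `R`: surjective because `Ω[R⁄R] = 0` (Mathlib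
  `KaehlerDifferential.exact_kerCotangentToTensor_mapBaseChange`, `subsingleton_of_surjective`), injective because `R` is formally smooth over `R` (Mathlib
  `Algebra.FormallySmooth.iff_split_injection`) — [EGAIV4] (16.9.8), [StacksProject] 031I∕00RU; stated through its consequences (no tensor product in a public statement):
  **`free_cotangent_augIdeal_of_free`** (`Ω[S⁄R]` free ⇒ `I/I²` free over `R`), **`finite_cotangent_augIdeal_of_finite`**′, and the `LinearEquiv` existence
  `nonempty_cotangent_augIdeal_linearEquiv_baseChange` for consumers who want the tensor.
* §2 For `S` STANDARD SMOOTH OF RELATIVE DIMENSION `n` ([StacksProject] 00T6; Mathlib `Algebra.IsStandardSmoothOfRelativeDimension`): **`free_cotangent_augIdeal`**,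
  **`finite_cotangent_augIdeal_of_isStandardSmooth`**, **`finrank_cotangent_augIdeal_eq`** (`= n`, `R` nontrivial), **`nonempty_cotangent_augIdeal_linearEquiv_fun`**
  (`I/I² ≃ₗ[R] (Fin n → R)`) — [GortzWedhorn2023] Prop. 27.15 ∕ Rem. 27.18 (4) for `X → Spec R` smooth of relative dimension `n` along a section: `e^*Ω¹` is locally free
  of rank `n`, here on a standard-smooth chart where it is free.
NOT here: the scheme-side chart of the unit section over a local base (brick (D1b) `AbelianSchemes/UnitSectionCotangentLocal`) and the `End`-action ∕ characteristic
polynomial (brick (D2) `AbelianSchemes/LieCharpolyLocal`).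

## References
* [EGAIV4] A. Grothendieck, J. Dieudonné, *EGA IV₄*, Publ. Math. IHÉS 32 (1967): (16.9.8), (17.2.3)–(17.2.5) (conormal sequence of a section of a smooth morphism).
* [GortzWedhorn2023] U. Görtz, T. Wedhorn, *Algebraic Geometry II* (2023): Def. 27.17, Rem. 27.18 (1)–(4), Prop. 27.15 (`Lie(G) = (e^*Ω¹_{G∕S})ᵛ`, locally free of rank `dim`).
* [BoschLutkebohmertRaynaud1990] S. Bosch, W. Lütkebohmert, M. Raynaud, *Néron Models* (1990): §4.2 Prop. 2 (`Ω¹_{G∕S} ≅ p^*e^*Ω¹_{G∕S}`).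
* [StacksProject] The Stacks project: Tag 031I (formal smoothness and the split conormal sequence), Tag 00RU, Tag 00T6 (standard smooth algebras).
-/

set_option autoImplicit false

noncomputable section

open TensorProduct KaehlerDifferential

namespace Literature.RingTheory.Smooth

universe u v

variable {R : Type u} {S : Type v} [CommRing R] [CommRing S] [Algebra R S] (ε : S →ₐ[R] R)

/-! ## §1 The conormal sequence of a section of a formally smooth algebra is an isomorphism -/

/-- An augmentation is surjective (`ε (algebraMap r) = r`). [cite: StacksProject, Tag 00RU] -/
theorem augmentation_surjective : Function.Surjective ε := fun r => ⟨algebraMap R S r, ε.commutes r⟩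

/-- With the `S`-algebra structure `ε` on `R`, `R → S → R` is a scalar tower (`ε ∘ algebraMap = id`). [cite: StacksProject, Tag 00RU] -/
theorem isScalarTower_of_augmentation : letI : Algebra S R := ε.toRingHom.toAlgebra; IsScalarTower R S R := by
  letI : Algebra S R := ε.toRingHom.toAlgebra
  refine IsScalarTower.of_algebraMap_eq fun r => ?_
  change algebraMap R R r = ε (algebraMap R S r)
  rw [AlgHom.commutes]

/-- **THE CONORMAL SEQUENCE OF A SECTION IS BIJECTIVE** for `S` formally smooth over `R`: the Mathlib map `I/I² → R ⊗_S Ω[S⁄R]`, `x ↦ 1 ⊗ dx`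
(`KaehlerDifferential.kerCotangentToTensor R S R` for the `S`-algebra structure `ε` on `R`) is injective (split, since `R` is formally smooth over `R`: Stacks 031I) and
surjective (its cokernel is `Ω[R⁄R] = 0`).  Generalises the tree's FIELD case ★ `CotangentDimensionAtRationalPoint.kerCotangentToTensor_bijective_of_formallySmooth`
(`K` a field) to an arbitrary base ring `R`, same Mathlib inputs. [cite: StacksProject, Tag 031I] [cite: EGAIV4, (16.9.8)] -/
theorem kerCotangentToTensor_bijective_of_augmentation [Algebra.FormallySmooth R S] :
    letI : Algebra S R := ε.toRingHom.toAlgebra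
    Function.Bijective (kerCotangentToTensor R S R) := by
  letI : Algebra S R := ε.toRingHom.toAlgebra
  haveI : IsScalarTower R S R := isScalarTower_of_augmentation ε
  have hsurj : Function.Surjective (algebraMap S R) := augmentation_surjective ε
  constructor
  · -- split injective (Stacks 031I with `A := R`, which is formally smooth over itself)
    obtain ⟨l, hl⟩ := (Algebra.FormallySmooth.iff_split_injection (R := R) (P := S) (A := R) hsurj).1 inferInstance
    exact Function.LeftInverse.injective (g := l) fun x => by
      have := LinearMap.congr_fun hl x
      simpa using this
  · -- surjective: the next term of the exact sequence is `Ω[R⁄R] = 0`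
    haveI : Subsingleton (Ω[R⁄R]) := KaehlerDifferential.subsingleton_of_surjective R R Function.surjective_id
    intro y
    have hy : KaehlerDifferential.mapBaseChange R S R y = 0 := Subsingleton.elim _ _
    exact ((KaehlerDifferential.exact_kerCotangentToTensor_mapBaseChange R S R hsurj) y).1 hy

/-- **`I/I² ≃ R ⊗_S Ω[S⁄R]` AS `R`-MODULES** (existence of the linear isomorphism, for consumers who want the tensor description; `R` is an `S`-algebra through `ε`).
[cite: EGAIV4, (16.9.8)] [cite: GortzWedhorn2023, Rem. 27.18 (4)] -/
theorem nonempty_cotangent_augIdeal_linearEquiv_baseChange [Algebra.FormallySmooth R S] :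
    letI : Algebra S R := ε.toRingHom.toAlgebra
    Nonempty ((augIdeal ε).Cotangent ≃ₗ[R] R ⊗[S] Ω[S⁄R]) := by
  letI : Algebra S R := ε.toRingHom.toAlgebra
  haveI : IsScalarTower R S R := isScalarTower_of_augmentation ε
  -- the `S`-linear bijection, restricted to `R`
  exact ⟨(LinearEquiv.ofBijective (kerCotangentToTensor R S R) (kerCotangentToTensor_bijective_of_augmentation ε)).restrictScalars R⟩

/-- **`Ω[S⁄R]` FREE ⇒ `I/I²` FREE over `R`** (for `S` formally smooth over `R`; e.g. `S` standard smooth). [cite: GortzWedhorn2023, Prop. 27.15 and Rem. 27.18 (4)] [cite: StacksProject, Tag 031I] -/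
theorem free_cotangent_augIdeal_of_free [Algebra.FormallySmooth R S] [Module.Free S (Ω[S⁄R])] : Module.Free R (augIdeal ε).Cotangent := by
  letI : Algebra S R := ε.toRingHom.toAlgebra
  haveI : IsScalarTower R S R := isScalarTower_of_augmentation ε
  obtain ⟨e⟩ := nonempty_cotangent_augIdeal_linearEquiv_baseChange ε
  haveI : Module.Free R (R ⊗[S] Ω[S⁄R]) := Module.Free.tensor
  exact Module.Free.of_equiv e.symm

/-- **`Ω[S⁄R]` FINITE ⇒ `I/I²` FINITE over `R`** (for `S` formally smooth; no noetherian hypothesis — compare ★ `finite_cotangent_augIdeal` for noetherian `S`).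
[cite: GortzWedhorn2023, Prop. 27.15] [cite: StacksProject, Tag 00RU] -/
theorem finite_cotangent_augIdeal_of_finite_kaehler [Algebra.FormallySmooth R S] [Module.Finite S (Ω[S⁄R])] : Module.Finite R (augIdeal ε).Cotangent := by
  letI : Algebra S R := ε.toRingHom.toAlgebra
  haveI : IsScalarTower R S R := isScalarTower_of_augmentation ε
  obtain ⟨e⟩ := nonempty_cotangent_augIdeal_linearEquiv_baseChange ε
  haveI : Module.Finite R (R ⊗[S] Ω[S⁄R]) := Module.Finite.base_change S R (Ω[S⁄R])
  exact Module.Finite.equiv e.symm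

/-- The rank of `I/I²` over `R` is the rank of `Ω[S⁄R]` over `S`, for `S` formally smooth with `Ω[S⁄R]` finite free (`R` nontrivial). [cite: GortzWedhorn2023, Prop. 27.15 and Rem. 27.18 (4)] -/
theorem finrank_cotangent_augIdeal_eq_finrank_kaehler [Nontrivial R] [Algebra.FormallySmooth R S] [Module.Free S (Ω[S⁄R])] [Module.Finite S (Ω[S⁄R])] :
    Module.finrank R (augIdeal ε).Cotangent = Module.finrank S (Ω[S⁄R]) := by
  letI : Algebra S R := ε.toRingHom.toAlgebra
  haveI : IsScalarTower R S R := isScalarTower_of_augmentation ε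
  haveI : Nontrivial S := RingHom.domain_nontrivial ε.toRingHom
  obtain ⟨e⟩ := nonempty_cotangent_augIdeal_linearEquiv_baseChange ε
  rw [e.finrank_eq, Module.finrank_baseChange]

/-! ## §2 Standard smooth of relative dimension `n`: `I/I²` is free of rank `n` -/

include ε in
/-- A ring admitting a ring map to a nontrivial ring is nontrivial; in particular an augmented `R`-algebra with `R` nontrivial. [cite: StacksProject, Tag 00RU] -/
theorem nontrivial_of_augmentation [Nontrivial R] : Nontrivial S := RingHom.domain_nontrivial ε.toRingHom

/-- **`I/I²` IS FREE** for `S` standard smooth (of some relative dimension `n`) over `R`. [cite: GortzWedhorn2023, Prop. 27.15 and Rem. 27.18 (4)] [cite: StacksProject, Tag 00T6] -/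
theorem free_cotangent_augIdeal (n : ℕ) [Algebra.IsStandardSmoothOfRelativeDimension n R S] : Module.Free R (augIdeal ε).Cotangent := by
  haveI : Algebra.IsStandardSmooth R S := Algebra.IsStandardSmoothOfRelativeDimension.isStandardSmooth n
  haveI : Algebra.Smooth R S := inferInstance
  haveI : Algebra.FormallySmooth R S := inferInstance
  exact free_cotangent_augIdeal_of_free ε

/-- **`I/I²` IS FINITE** for `S` standard smooth over `R` (finitely presented ⇒ `Ω[S⁄R]` finite). [cite: GortzWedhorn2023, Prop. 27.15] [cite: StacksProject, Tag 00T6] -/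
theorem finite_cotangent_augIdeal_of_isStandardSmooth (n : ℕ) [Algebra.IsStandardSmoothOfRelativeDimension n R S] : Module.Finite R (augIdeal ε).Cotangent := by
  haveI : Algebra.IsStandardSmooth R S := Algebra.IsStandardSmoothOfRelativeDimension.isStandardSmooth n
  haveI : Algebra.Smooth R S := inferInstance
  haveI : Algebra.FormallySmooth R S := inferInstance
  haveI : Algebra.FinitePresentation R S := inferInstance
  haveI : Module.Finite S (Ω[S⁄R]) := inferInstance
  exact finite_cotangent_augIdeal_of_finite_kaehler ε

/-- **`rank_R (I/I²) = n`** for `S` standard smooth of relative dimension `n` over a nontrivial `R` (`rank_S Ω[S⁄R] = n`, Mathlib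
`IsStandardSmoothOfRelativeDimension.rank_kaehlerDifferential`). [cite: GortzWedhorn2023, Prop. 27.15 and Rem. 27.18 (4)] [cite: EGAIV4, (17.2.3)] -/
theorem finrank_cotangent_augIdeal_eq [Nontrivial R] (n : ℕ) [Algebra.IsStandardSmoothOfRelativeDimension n R S] :
    Module.finrank R (augIdeal ε).Cotangent = n := by
  haveI : Nontrivial S := nontrivial_of_augmentation ε
  haveI : Algebra.IsStandardSmooth R S := Algebra.IsStandardSmoothOfRelativeDimension.isStandardSmooth n
  haveI : Algebra.Smooth R S := inferInstance
  haveI : Algebra.FormallySmooth R S := inferInstance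
  haveI : Algebra.FinitePresentation R S := inferInstance
  haveI : Module.Finite S (Ω[S⁄R]) := inferInstance
  rw [finrank_cotangent_augIdeal_eq_finrank_kaehler ε]
  exact Module.finrank_eq_of_rank_eq (Algebra.IsStandardSmoothOfRelativeDimension.rank_kaehlerDifferential n)

/-- **`I/I² ≃ R^n`**: for `S` standard smooth of relative dimension `n` over a nontrivial `R`, the conormal module of an augmentation is free of rank `n` — the ALGEBRA of
«`e^*Ω¹_{X∕R}` is locally free of rank `n` for `X → Spec R` smooth of relative dimension `n`» on a standard-smooth chart of the section.
[cite: GortzWedhorn2023, Prop. 27.15 and Rem. 27.18 (4)] [cite: EGAIV4, (17.2.3)] -/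
theorem nonempty_cotangent_augIdeal_linearEquiv_fun [Nontrivial R] (n : ℕ) [Algebra.IsStandardSmoothOfRelativeDimension n R S] :
    Nonempty ((augIdeal ε).Cotangent ≃ₗ[R] (Fin n → R)) := by
  haveI : Module.Free R (augIdeal ε).Cotangent := free_cotangent_augIdeal ε n
  haveI : Module.Finite R (augIdeal ε).Cotangent := finite_cotangent_augIdeal_of_isStandardSmooth ε n
  exact ⟨(Module.finBasisOfFinrankEq R (augIdeal ε).Cotangent (finrank_cotangent_augIdeal_eq ε n)).equivFun⟩

end Literature.RingTheory.Smooth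

end
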